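import Literature.NumberTheory.Rogawski1990.ArchBouazizRegularGerms          -- ★ p851525 (this seat): `bzLocalSurjRegular_of_parts`
import Literature.NumberTheory.Rogawski1990.ArchBouazizClassTube             -- ★ p851533 (LH3-p04 (g5)): (T0)(T2)(T3) `mem_regS_of_sq_ne_four_mul`, `exists_forall_chart_eq_of_dist_bzClassMap_lt`, `abs_coord_zero_le_log_of_dist_bzClassMap_lt`
import Literature.NumberTheory.Rogawski1990.ArchBouazizClassMapClosedRange   -- ★ p851511 (F0P3a-p09 (g8)): `isClosed_range_bzClassMap`
import Literature.NumberTheory.Rogawski1990.ArchBouazizClassDescent          -- ★ p851524 (LH10-p02 (g7)): `exists_classDescent_of_section_of_descent`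
import Literature.NumberTheory.Rogawski1990.ArchBouazizChartDescent          -- ★ p851534 (LH3-p03 (g6) ∕ LH10-p02 (g7)): `div_eq_div_of_bzClassMap_eq`
import HarnessLib

/-!
# (Σ-REG) MODULO ONE NAMED INPUT — local surjectivity at a regular base class from the smooth local SECTION of the class map alone (Bouaziz 1994 §5.1; Varadarajan 1989 §6.2)

Topic `NumberTheory/Rogawski1990`; namespace `Literature.NumberTheory.Rogawski1990`.  THEOREMS ONLY (no `def`, no instance, no notation, no axiom, no named fact, no `sorry`).
Cell `pub/hodgecm-mathlib`, crux H413 (`stmt-HodgeConjecture-24833`), line LH3 (closer stub `stub_N9`), letter L3′ SURJ-OF-FORWARD road (RULINGS #22∕#23∕#25, LH3-plan (g4)); SURJ binder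
LH10-p01 (g5) (★ `bouazizSurjOfForward_of_reg_wall`, p851508, organ binder `hreg`); (Σ-REG) binder F0P3a-p04 (g25).  Author F0P3a-p04 (g25).  Count-neutral.

WHAT.  ★ `bzLocalSurjRegular_of_parts` (p851525) proves the (Σ-REG) organ from five group-free inputs.  Four of them are ★ and are discharged here BY BARE NAMES:
(g1) ★ `mem_regS_of_sq_ne_four_mul`, (T2) ★ `exists_forall_chart_eq_of_dist_bzClassMap_lt`, (T3) ★ `abs_coord_zero_le_log_of_dist_bzClassMap_lt` (LH3-p04 (g5), p851533), (img) ★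
`isClosed_range_bzClassMap` (F0P3a-p09 (g8), p851511); the fifth, the (Σ4c) descent, is ★ `exists_classDescent_of_section_of_descent` (LH10-p02 (g7), p851524) over ★
`div_eq_div_of_bzClassMap_eq` (p851534) MODULO the smooth local SECTION of `bzClassMap S` at a regular chart point — the ONE remaining named input, kept as the hypothesis `hsec`
((Σ4c-sec), LH3-p03 (g6): `exists_contDiffOn_section_bzClassMap`, whose first three conjuncts are exactly `hsec`).
* **`bzLocalSurjRegular_of_section (hsec) (jcH) (hfwd) (b) (hb) : ‹the hreg body of ★ p851480∕p851508 at (L, νH, jcH)›`**.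
HONEST LABEL: L3′ stays PRINT-labelled ((Σ-WALL) organ; in-house W-road censused by LH3-p01 (g6)) until paid; HC_CM is proved only modulo the 7 printed citations (2 remaining:
hLiu418 = stmt-HodgeConjecture-24832, h413 = stmt-HodgeConjecture-24833) until rung 0 closes; assembly bookkeeping, pays nothing by itself.

## References
* [Bouaziz1994IntegralesOrbitales] A. Bouaziz, *Intégrales orbitales sur les groupes de Lie réductifs*, Ann. Sci. ÉNS (4) 27 (1994) 573–609, §5.1 p. 588, Thm. 6.2.1 (i) p. 592.
* [Varadarajan1989] V. S. Varadarajan, *An Introduction to Harmonic Analysis on Semisimple Lie Groups*, Cambridge Stud. Adv. Math. 16 (1989), §6.2.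
-/

set_option autoImplicit false

noncomputable section

open MeasureTheory NumberField NumberField.InfinitePlace Complex Set Function Filter Topology
open Literature.NumberTheory.Automorphic Literature.NumberTheory.Automorphic.UnitaryGroup Literature.NumberTheory.Automorphic.ArchCartan
open scoped Classical ContDiff

namespace Literature.NumberTheory.Rogawski1990

section OfSection

variable (L : Type) [Field L] [NumberField L] [IsCMField L]
  [MeasurableSpace (↥(arch (↥(maximalRealSubfield L)) L (IsCMField.complexConj L) 2 (Matrix.of fun i j : Fin 2 => if i.val + j.val + 1 = 2 then (1 : L) else 0)) ×
      ↥(arch (↥(maximalRealSubfield L)) L (IsCMField.complexConj L) 1 (Matrix.of fun i j : Fin 1 => if i.val + j.val + 1 = 1 then (1 : L) else 0)))]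
  [BorelSpace (↥(arch (↥(maximalRealSubfield L)) L (IsCMField.complexConj L) 2 (Matrix.of fun i j : Fin 2 => if i.val + j.val + 1 = 2 then (1 : L) else 0)) ×
      ↥(arch (↥(maximalRealSubfield L)) L (IsCMField.complexConj L) 1 (Matrix.of fun i j : Fin 1 => if i.val + j.val + 1 = 1 then (1 : L) else 0)))]
  (νH : Measure (↥(arch (↥(maximalRealSubfield L)) L (IsCMField.complexConj L) 2 (Matrix.of fun i j : Fin 2 => if i.val + j.val + 1 = 2 then (1 : L) else 0)) ×
      ↥(arch (↥(maximalRealSubfield L)) L (IsCMField.complexConj L) 1 (Matrix.of fun i j : Fin 1 => if i.val + j.val + 1 = 1 then (1 : L) else 0))))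
  [νH.IsHaarMeasure] [νH.IsMulRightInvariant]

/-- **(Σ-REG) FROM THE SMOOTH LOCAL SECTION OF THE CLASS MAP ALONE** — the `hreg` organ of ★ `bouazizSurjOfForward_of_reg_wall` (p851508) at `(L, νH, jcH)`, all other inputs
discharged by their ★ names (file docstring). [cite: Bouaziz1994IntegralesOrbitales, §5.1 p. 588; Thm. 6.2.1 (i) p. 592] [cite: Varadarajan1989, §6.2] -/
theorem bzLocalSurjRegular_of_section
    (hsec : ∀ (S : Finset {w : InfinitePlace L // IsComplex w}) {c₀ : {w : InfinitePlace L // IsComplex w} → Fin 3 → ℝ}, c₀ ∈ RegS S →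
      ∃ U : Set ({w : InfinitePlace L // IsComplex w} → ℂ × ℂ × ℂ), IsOpen U ∧ bzClassMap S c₀ ∈ U ∧
        ∃ σ : ({w : InfinitePlace L // IsComplex w} → ℂ × ℂ × ℂ) → ({w : InfinitePlace L // IsComplex w} → Fin 3 → ℝ), ContDiffOn ℝ ∞ σ U ∧ σ (bzClassMap S c₀) = c₀ ∧
          ∀ c : {w : InfinitePlace L // IsComplex w} → Fin 3 → ℝ, bzClassMap S c ∈ U → bzClassMap S (σ (bzClassMap S c)) = bzClassMap S c)
    (jcH : Finset {w : InfinitePlace L // IsComplex w} → {w : InfinitePlace L // IsComplex w} → ℂ)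
    (hfwd : ∀ fH : ↥(arch (↥(maximalRealSubfield L)) L (IsCMField.complexConj L) 2 (Matrix.of fun i j : Fin 2 => if i.val + j.val + 1 = 2 then (1 : L) else 0)) ×
        ↥(arch (↥(maximalRealSubfield L)) L (IsCMField.complexConj L) 1 (Matrix.of fun i j : Fin 1 => if i.val + j.val + 1 = 1 then (1 : L) else 0)) → ℂ,
      ArchSmooth₂ L fH → ArchBouazizSpaceH jcH (stOrbFamH L νH fH))
    (b : {w : InfinitePlace L // IsComplex w} → ℂ × ℂ × ℂ) (hb : ∀ w, (b w).1 ^ 2 ≠ 4 * (b w).2.1) :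
    ∃ ε : ℝ, 0 < ε ∧
      ∀ Ψ : Finset {w : InfinitePlace L // IsComplex w} → ({w : InfinitePlace L // IsComplex w} → Fin 3 → ℝ) → ℂ, ArchBouazizSpaceH jcH Ψ →
        ∃ fH : ↥(arch (↥(maximalRealSubfield L)) L (IsCMField.complexConj L) 2 (Matrix.of fun i j : Fin 2 => if i.val + j.val + 1 = 2 then (1 : L) else 0)) ×
            ↥(arch (↥(maximalRealSubfield L)) L (IsCMField.complexConj L) 1 (Matrix.of fun i j : Fin 1 => if i.val + j.val + 1 = 1 then (1 : L) else 0)) → ℂ,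
          ArchSmooth₂ L fH ∧ ∀ (S : Finset {w : InfinitePlace L // IsComplex w}) (c : {w : InfinitePlace L // IsComplex w} → Fin 3 → ℝ),
            c ∈ RegS S → dist (bzClassMap S c) b < ε → stOrbFamH L νH fH S c = Ψ S c :=
  bzLocalSurjRegular_of_parts L νH (fun S c h => mem_regS_of_sq_ne_four_mul S c h) (fun b hb => exists_forall_chart_eq_of_dist_bzClassMap_lt b hb)
    (fun S c b ε w hw h => abs_coord_zero_le_log_of_dist_bzClassMap_lt S c b ε w hw h) (fun S => isClosed_range_bzClassMap S)
    (fun S _ hc₀ Φ _ hε₀ hΦP hΦW hΦX hΦs hΦ0 =>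
      exists_classDescent_of_section_of_descent S hc₀ Φ hε₀ hΦs hΦ0 (hsec S hc₀)
        (fun _ hP hW hX _ _ hc hc' h hΦ => div_eq_div_of_bzClassMap_eq S hP hW hX hΦP hΦW hΦX hc hc' h hΦ))
    jcH hfwd b hb

end OfSection

end Literature.NumberTheory.Rogawski1990

end
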